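import Literature.Geometry.Lorentzian.GerochMonotonicity
import Literature.Geometry.Lorentzian.InverseMeanCurvatureFlowArea
import Literature.Geometry.Lorentzian.SecondFundamentalFormNormSq
import Literature.Geometry.Lorentzian.GreenIdentity
import Literature.Geometry.Lorentzian.MeanCurvatureRegularity
import HarnessLib

/-!
# Inverse mean curvature flow III: the Monotonicity Calculation at a fixed time, and the
# reduction of `geroch_monotonicity_smooth` to its four classical inputs
(family `gr`; second proved layer towards the named fact
`Literature.Geometry.Lorentzian.geroch_monotonicity_smooth` of `InverseMeanCurvatureFlow.lean`,
continuing `GerochMonotonicity.lean`)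

Huisken–Ilmanen, J. Differential Geom. 59 (2001), §5, "Monotonicity Calculation" (printed
pp. 40–41), smooth case. For a smooth solution `(N_t)` of the inverse mean curvature flow by
closed surfaces in a Riemannian `3`-manifold `(X, h)`:

1. by the first variation of area (1.1), `∂_t dμ_t = dμ_t`, and the evolution equation (1.3),
   `∂_t H = -Δ(H⁻¹) - |A|² H⁻¹ - Rc(ν,ν) H⁻¹`, differentiating under the integral sign,
   `d/dt ∫_{N_t} H² = ∫_{N_t} (2H ∂_t H + H²) = ∫_{N_t} (-2H Δ(H⁻¹) - 2|A|² - 2Rc(ν,ν) + H²)`;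
2. by the Gauss equation `2K = R - 2Rc(ν,ν) + H² - |A|²` (`K` the Gauss curvature of `N_t`,
   `R` the scalar curvature of `h`), the identity `|A|² = ½H² + ½(λ₁-λ₂)²`, the integration by
   parts `∫ -2HΔ(H⁻¹) = -2∫ |DH|²/H² ≤ 0` on the closed surface `N_t`, and the Gauss–Bonnet
   formula `∫_{N_t} K = 2πχ(N_t) ≤ 4π` for connected `N_t`,
   `d/dt ∫_{N_t} H² = ∫ (-2|DH|²/H² - |A|² - R + 2K) ≤ 4πχ(N_t) - ½∫H² ≤ ½ (16π - ∫_{N_t} H²)`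
   provided `R ≥ 0`;
3. hence `e^{t/2}(16π - ∫_{N_t} H²)` is nondecreasing and, as `|N_t|^{1/2} ∝ e^{t/2}` by (1.1),
   `m_H(N_t)` is nondecreasing (steps 2–3, proved in `GerochMonotonicity.lean`).

This file PROVES the calculation of step 2 above — the passage from the four classical inputs to
the differential inequality — and assembles everything that is now in the tree:

* `geroch_integrand_eq`, `geroch_integrand_le` — the pointwise algebra: with
  `dH = -L - (|A|² + Rc)/H` and `2K = R - 2Rc + H² - |A|²`,
  `2HdH + H² = -2HL - |A|² - R + 2K ≤ -2HL + 2K - ½H²` when `½H² ≤ |A|²` and `R ≥ 0`;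
* `integral_geroch_le` — the integrated form over an arbitrary measure space:
  `∫(2HdH + H²) ≤ ½(16π - ∫H²)` given in addition `0 ≤ ∫ H L` (the integration by parts) and
  `∫ 2K ≤ 8π` (Gauss–Bonnet with `χ ≤ 2`);
* `IsClassicalIMCF.hasDerivAt_sqMeanCurvatureIntegral_le` — **step 1 of the Monotonicity
  Calculation for a classical solution at a time `t ∈ (a, b)`, from its classical inputs stated
  in the tree's vocabulary** for the leaf `N_t = F_t(S)` with induced metric `F_t^* h`
  (`inducedMetric`), area measure `dμ_t` (`riemannianVolume _ 2`), mean curvature `H`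
  (`meanCurvature`), second fundamental form `A` (`secondFundamentalForm`, `|A|²` its `normSq`),
  `Rc(ν,ν)` (`ricci` of `h`), `2K` (`scalarCurvature` of `F_t^* h`) and `Δ = Δ_{F_t^* h}`
  (`dalembertian` of `F_t^* h`): (F1) `W = ∫H²` has derivative `∫(2HdH + H²) dμ_t` at `t` with
  `dH = -Δ(H⁻¹) - (|A|² + Rc(ν,ν))/H` ((1.1), (1.3) and differentiation under the integral);
  (F2) the Gauss equation; (F3) `∫_{N_t} 2K dμ_t ≤ 8π`; (F4) `0 ≤ ∫_{N_t} H Δ(H⁻¹) dμ_t`; and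
  `R ≥ 0`. The inequality `½H² ≤ |A|²` is the theorem
  `half_meanCurvature_sq_le_normSq_secondFundamentalForm` (`SecondFundamentalFormNormSq.lean`).
  Conclusion: `∃ W', HasDerivAt W W' t ∧ W' ≤ ½(16π - W t)`, the hypothesis `hW` of
  `IsClassicalIMCF.hawkingMass_mono`;
* `geroch_monotonicity_smooth_of_hasDerivAt` — **the named fact from step 1 alone**: now that
  (1.1) is the theorem `area_exp_classical_holds` (`InverseMeanCurvatureFlowArea.lean`), the
  differential inequality of step 1 for every classical solution by a compact connected surface
  in a `3`-manifold with `R ≥ 0` implies `geroch_monotonicity_smooth`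
  (`IsClassicalIMCF.hawkingMass_mono_of_area_exp`);
* `geroch_monotonicity_smooth_of_inputs` — the same from the inputs (F1)–(F4) for every such
  solution and time;
* `IsClassicalIMCF.integral_meanCurvature_mul_dalembertian_inv_nonneg` — **(F4) is a theorem**
  for leaves whose mean curvature is `C²`: `0 ≤ ∫_{N_t} H Δ(H⁻¹) dμ_t`, by Green's first identity
  on the closed surface `N_t` (`GreenIdentity.lean`: `∫ H Δ(H⁻¹) = ∫ |dH|²/H² ≥ 0`); hence
  `IsClassicalIMCF.hasDerivAt_sqMeanCurvatureIntegral_le_of_contMDiff` and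
  `geroch_monotonicity_smooth_of_inputs_of_contMDiff`, the reductions with (F4) replaced by the
  regularity hypothesis `H ∈ C²(N_t)`;
* `IsClassicalIMCF.contMDiff_meanCurvature` — that regularity holds: the mean curvature of every
  leaf of a classical solution is `C^∞` (`MeanCurvatureRegularity.lean`), so (F4) is discharged
  outright (`IsClassicalIMCF.integral_meanCurvature_mul_dalembertian_inv_nonneg'`) and step 1 /
  the named fact follow from (F1)–(F3) alone
  (`IsClassicalIMCF.hasDerivAt_sqMeanCurvatureIntegral_le_of_F123`,
  `geroch_monotonicity_smooth_of_inputs₃`).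

What therefore remains for `geroch_monotonicity_smooth_holds` is (F1)–(F3) as theorems — the
evolution of `H` under the flow with differentiation of `∫ H² dμ_t` under the integral sign, the
Gauss equation for immersed surfaces, and the Gauss–Bonnet theorem with `χ(N_t) ≤ 2` for closed
connected surfaces — none of which Mathlib or the tree has at present; (F4) is supplied by
`GreenIdentity.lean` and `MeanCurvatureRegularity.lean`. No definition and no named fact is
introduced here.

## Mathlib

Used: the Bochner integral API (`integral_mono`, `integral_add/sub`, `integral_const_mul`,
`Integrable` algebra), `HasDerivAt`. Mathlib has no Gauss–Bonnet theorem, Gauss equation or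
divergence theorem on manifolds (see the module docstrings of `InverseMeanCurvatureFlow.lean` and
`GerochMonotonicity.lean`).

## Design choices

* (F1) is split as in the source into a derivative statement for an auxiliary function
  `dH : S → ℝ` (meant: `∂_t H` at time `t`) and the evolution equation (1.3) for it; only their
  conjunction matters, and no definition of `∂_t H` as a function of `t` (which would have to
  thread the proof `t ∈ (a, b)` through `meanCurvature`) is needed.
* (F4) enters as the inequality `0 ≤ ∫ H Δ(H⁻¹)` which is what the calculation uses; the source
  obtains it from Green's identity `∫ H Δ(H⁻¹) = -∫ ⟨DH, D(H⁻¹)⟩ = ∫ |DH|²/H²`.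
* (F3) enters as `∫_{N_t} 2K dμ_t ≤ 8π` with `2K` the scalar curvature of the induced metric (for a
  surface the scalar curvature is twice the Gauss curvature); the source: Gauss–Bonnet and
  `χ(N_t) ≤ 2` for connected `N_t`. Connectedness of `S` is not used otherwise, so the fixed-time
  theorem does not assume it.
* Integrability on `N_t` of `H Δ(H⁻¹)`, `|A|²`, `R ∘ F_t`, `2K` and `H²` is assumed (for a smooth
  solution these are continuous functions on the compact surface; the tree's curvature objects
  carry no regularity statements by themselves).
* The Levi-Civita connection of the induced metric `F_t^* h` (needed for its `scalarCurvature`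
  and `dalembertian`) exists by `PseudoRiemannianMetric.hasLeviCivita` (`LeviCivitaProofs.lean`),
  introduced inline in the statements.

## References

* G. Huisken, T. Ilmanen, *The inverse mean curvature flow and the Riemannian Penrose
  inequality*, J. Differential Geom. 59 (2001) 353–437: §5, Monotonicity Calculation (smooth
  case), printed pp. 40–41; §1, (1.1), (1.3).
* R. Geroch, *Energy extraction*, Ann. New York Acad. Sci. 224 (1973) 108–117.
* P. S. Jang, R. M. Wald, *The positive energy conjecture and the cosmic censor hypothesis*,
  J. Math. Phys. 18 (1977) 41–44.
-/

noncomputable section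

open Bundle Set Manifold TopologicalSpace Filter MeasureTheory
open scoped ContDiff Topology ENNReal Manifold Real

namespace Literature.Geometry.Lorentzian

open PseudoRiemannianMetric

/-! ### The pointwise algebra of the Monotonicity Calculation -/

/-- **The integrand of `d/dt ∫ H²` after (1.3) and the Gauss equation.** For real numbers with
`H ≠ 0`, `dH = -L - (A₂ + Rc)/H` ((1.3), `L = Δ(H⁻¹)`, `A₂ = |A|²`, `Rc = Rc(ν,ν)`) and
`R₂ = R - 2Rc + H² - A₂` (Gauss equation, `R₂ = 2K`):
`2HdH + H² = -2HL - 2A₂ - 2Rc + H² = -2HL - A₂ - R + R₂`. Huisken–Ilmanen 2001, §5, Monotonicity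
Calculation, first two lines of the display. [cite: HuiskenIlmanenIMCF2001, §5 Monotonicity Calculation (smooth case), lines 1–2] -/
theorem geroch_integrand_eq {H dH L A₂ Rc R R₂ : ℝ} (hH : H ≠ 0)
    (hevol : dH = -L - (A₂ + Rc) / H) (hGauss : R₂ = R - 2 * Rc + H ^ 2 - A₂) :
    2 * H * dH + H ^ 2 = -2 * (H * L) - A₂ - R + R₂ := by
  rw [hevol, hGauss]
  field_simp
  ring

/-- **The pointwise inequality of the Monotonicity Calculation.** Under the hypotheses of
`geroch_integrand_eq` and `½H² ≤ A₂` (`|A|² = ½H² + ½(λ₁-λ₂)²`), `0 ≤ R`: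
`2HdH + H² ≤ -2HL + R₂ - ½H²`. Huisken–Ilmanen 2001, §5, Monotonicity Calculation, lines 2–4 of
the display (dropping `-½(λ₁-λ₂)²` and `-R`). [cite: HuiskenIlmanenIMCF2001, §5 Monotonicity Calculation (smooth case), lines 2–4] -/
theorem geroch_integrand_le {H dH L A₂ Rc R R₂ : ℝ} (hH : H ≠ 0)
    (hevol : dH = -L - (A₂ + Rc) / H) (hGauss : R₂ = R - 2 * Rc + H ^ 2 - A₂)
    (hA : 2⁻¹ * H ^ 2 ≤ A₂) (hR : 0 ≤ R) :
    2 * H * dH + H ^ 2 ≤ -2 * (H * L) + R₂ - 2⁻¹ * H ^ 2 := by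
  rw [geroch_integrand_eq hH hevol hGauss]
  linarith

/-- **The integrated Monotonicity Calculation** over an arbitrary measure space (the leaf `N_t`
with its area measure): if pointwise `H ≠ 0`, `dH = -L - (A₂ + Rc)/H`, `R₂ = R - 2Rc + H² - A₂`,
`½H² ≤ A₂`, `0 ≤ R`, the functions `H L`, `A₂`, `R`, `R₂`, `H²` are integrable, the integration
by parts gives `0 ≤ ∫ H L` (`= ∫ |DH|²/H²`) and Gauss–Bonnet gives `∫ R₂ ≤ 8π` (`R₂ = 2K`,
`χ ≤ 2`), then `∫ (2HdH + H²) ≤ -2∫HL + ∫R₂ - ½∫H² ≤ ½ (16π - ∫ H²)`. Huisken–Ilmanen 2001, §5,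
Monotonicity Calculation (smooth case), the whole display. [cite: HuiskenIlmanenIMCF2001, §5 Monotonicity Calculation (smooth case)] -/
theorem integral_geroch_le {α : Type*} [MeasurableSpace α] {μ : Measure α}
    {H dH L A₂ Rc R R₂ : α → ℝ} (hH : ∀ y, H y ≠ 0)
    (hevol : ∀ y, dH y = -L y - (A₂ y + Rc y) / H y)
    (hGauss : ∀ y, R₂ y = R y - 2 * Rc y + H y ^ 2 - A₂ y)
    (hA : ∀ y, 2⁻¹ * H y ^ 2 ≤ A₂ y) (hR : ∀ y, 0 ≤ R y)
    (hHL : Integrable (fun y ↦ H y * L y) μ) (hA₂ : Integrable A₂ μ) (hRi : Integrable R μ)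
    (hR₂ : Integrable R₂ μ) (hH₂ : Integrable (fun y ↦ H y ^ 2) μ)
    (hIBP : 0 ≤ ∫ y, H y * L y ∂μ) (hGB : ∫ y, R₂ y ∂μ ≤ 8 * π) :
    ∫ y, (2 * H y * dH y + H y ^ 2) ∂μ ≤ 2⁻¹ * (16 * π - ∫ y, H y ^ 2 ∂μ) := by
  have hpt : ∀ y, 2 * H y * dH y + H y ^ 2 = -2 * (H y * L y) - A₂ y - R y + R₂ y := fun y ↦
    geroch_integrand_eq (hH y) (hevol y) (hGauss y)
  have hle : ∀ y, 2 * H y * dH y + H y ^ 2 ≤ -2 * (H y * L y) + R₂ y - 2⁻¹ * H y ^ 2 := fun y ↦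
    geroch_integrand_le (hH y) (hevol y) (hGauss y) (hA y) (hR y)
  have hint_l : Integrable (fun y ↦ 2 * H y * dH y + H y ^ 2) μ := by
    have heq : (fun y ↦ 2 * H y * dH y + H y ^ 2) =
        fun y ↦ -2 * (H y * L y) - A₂ y - R y + R₂ y := funext hpt
    rw [heq]
    exact (((hHL.const_mul (-2)).sub hA₂).sub hRi).add hR₂
  have hint_r : Integrable (fun y ↦ -2 * (H y * L y) + R₂ y - 2⁻¹ * H y ^ 2) μ :=
    ((hHL.const_mul (-2)).add hR₂).sub (hH₂.const_mul 2⁻¹)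
  calc ∫ y, (2 * H y * dH y + H y ^ 2) ∂μ
      ≤ ∫ y, (-2 * (H y * L y) + R₂ y - 2⁻¹ * H y ^ 2) ∂μ := integral_mono hint_l hint_r hle
    _ = -2 * ∫ y, H y * L y ∂μ + ∫ y, R₂ y ∂μ - 2⁻¹ * ∫ y, H y ^ 2 ∂μ := by
        have h1 : ∫ y, (-2 * (H y * L y) + R₂ y - 2⁻¹ * H y ^ 2) ∂μ =
            ∫ y, (-2 * (H y * L y) + R₂ y) ∂μ - ∫ y, 2⁻¹ * H y ^ 2 ∂μ :=
          integral_sub ((hHL.const_mul (-2)).add hR₂) (hH₂.const_mul 2⁻¹)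
        have h2 : ∫ y, (-2 * (H y * L y) + R₂ y) ∂μ =
            ∫ y, -2 * (H y * L y) ∂μ + ∫ y, R₂ y ∂μ :=
          integral_add (hHL.const_mul (-2)) hR₂
        rw [h1, h2, integral_const_mul, integral_const_mul]
    _ ≤ 2⁻¹ * (16 * π - ∫ y, H y ^ 2 ∂μ) := by nlinarith

/-! ### Step 1 for a classical solution at a fixed time, from its classical inputs -/

section Classical

variable {X : Type*} [TopologicalSpace X] [ChartedSpace E3 X] [IsManifold (𝓡 3) ∞ X]
  {h : ContMDiffRiemannianMetric (𝓡 3) ∞ E3 (TangentSpace (𝓡 3) : X → Type _)}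
  [(ofRiemannian h).HasLeviCivita]
  {S : Type*} [TopologicalSpace S] [ChartedSpace (EuclideanSpace ℝ (Fin 2)) S]
  [IsManifold (𝓡 2) ∞ S] [CompactSpace S] [T2Space S] [MeasurableSpace S] [BorelSpace S]
  {hpb : contMDiff_pullbackBilin (𝓡 3) X (𝓡 2) S ∞}
  {F : ℝ → S → X} {ν : (t : ℝ) → NormalField (𝓡 3) (F t)} {a b : ℝ}

/-- **Step 1 of Huisken–Ilmanen's Monotonicity Calculation, from its classical inputs.** Let
`(F, ν)` be a classical solution of the inverse mean curvature flow on `(a, b)` by a compact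
surface `S` in the Riemannian `3`-manifold `(X, h)` with `R ≥ 0`, and `t ∈ (a, b)`; write
`g_t = F_t^* h` for the induced metric of the leaf `N_t`, `dμ_t` for its area measure, `H > 0`
for the mean curvature, `A` for the second fundamental form, `W(t) = ∫_{N_t} H² dμ_t`. Assume:
(F1) `W` has derivative `∫_{N_t} (2HdH + H²) dμ_t` at `t` for a function `dH` (`= ∂_t H`; first
variation of area (1.1), `∂_t dμ_t = dμ_t`, and differentiation under the integral sign)
satisfying the evolution equation (1.3), `dH = -Δ_{g_t}(H⁻¹) - (|A|²_{g_t} + Rc_h(ν,ν))/H`;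
(F2) the Gauss equation `R(g_t) = R(h) ∘ F_t - 2Rc_h(ν,ν) + H² - |A|²` (`R(g_t) = 2K`);
(F3) the Gauss–Bonnet bound `∫_{N_t} R(g_t) dμ_t ≤ 8π` (`∫ K = 2πχ(N_t) ≤ 4π`, `N_t` connected);
(F4) `0 ≤ ∫_{N_t} H Δ_{g_t}(H⁻¹) dμ_t` (integration by parts on the closed surface:
`= ∫ |DH|²/H²`); and integrability on `N_t` of `H Δ(H⁻¹)`, `|A|²`, `R(h) ∘ F_t`, `R(g_t)`, `H²`.
Then `W'(t) ≤ ½ (16π - W(t))` — with `½H² ≤ |A|²`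
(`half_meanCurvature_sq_le_normSq_secondFundamentalForm`) this is `integral_geroch_le`.
Huisken–Ilmanen 2001, §5, Monotonicity Calculation (smooth case): "we find by (1.1) and (1.3)
that … provided that `N_t` is connected and `R ≥ 0`".
[cite: HuiskenIlmanenIMCF2001, §5 Monotonicity Calculation (smooth case), step 1] -/
theorem IsClassicalIMCF.hasDerivAt_sqMeanCurvatureIntegral_le (Hc : IsClassicalIMCF h hpb F ν a b)
    (hR : ∀ x : X, 0 ≤ (ofRiemannian h).scalarCurvature x) {t : ℝ} (ht : t ∈ Set.Ioo a b)
    {dH : S → ℝ}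
    (hD : HasDerivAt Hc.sqMeanCurvatureIntegral
      (∫ y, (2 * (ofRiemannian h).meanCurvature (F t) hpb (Hc.isSpacelikeImmersion t ht) (ν t) y *
          dH y + (ofRiemannian h).meanCurvature (F t) hpb (Hc.isSpacelikeImmersion t ht) (ν t) y ^ 2)
        ∂(riemannianVolume ((ofRiemannian h).inducedRiemannianMetric (F t) hpb
          (Hc.isSpacelikeImmersion t ht)) 2)) t)
    (hevol : haveI := ((ofRiemannian h).inducedMetric (F t) hpb
        (Hc.isSpacelikeImmersion t ht)).hasLeviCivita
      ∀ y, dH y =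
        -((ofRiemannian h).inducedMetric (F t) hpb (Hc.isSpacelikeImmersion t ht)).dalembertian
            (fun z ↦ ((ofRiemannian h).meanCurvature (F t) hpb (Hc.isSpacelikeImmersion t ht)
              (ν t) z)⁻¹) y -
          (((ofRiemannian h).inducedMetric (F t) hpb (Hc.isSpacelikeImmersion t ht)).normSq y
              ((ofRiemannian h).secondFundamentalForm (𝓡 2) (F t) (ν t) y) +
            (ofRiemannian h).ricci (F t y) (ν t y) (ν t y)) /
          (ofRiemannian h).meanCurvature (F t) hpb (Hc.isSpacelikeImmersion t ht) (ν t) y)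
    (hGauss : haveI := ((ofRiemannian h).inducedMetric (F t) hpb
        (Hc.isSpacelikeImmersion t ht)).hasLeviCivita
      ∀ y, ((ofRiemannian h).inducedMetric (F t) hpb (Hc.isSpacelikeImmersion t ht)).scalarCurvature y =
        (ofRiemannian h).scalarCurvature (F t y) - 2 * (ofRiemannian h).ricci (F t y) (ν t y) (ν t y) +
          (ofRiemannian h).meanCurvature (F t) hpb (Hc.isSpacelikeImmersion t ht) (ν t) y ^ 2 -
          ((ofRiemannian h).inducedMetric (F t) hpb (Hc.isSpacelikeImmersion t ht)).normSq y
            ((ofRiemannian h).secondFundamentalForm (𝓡 2) (F t) (ν t) y))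
    (hGB : haveI := ((ofRiemannian h).inducedMetric (F t) hpb
        (Hc.isSpacelikeImmersion t ht)).hasLeviCivita
      ∫ y, ((ofRiemannian h).inducedMetric (F t) hpb (Hc.isSpacelikeImmersion t ht)).scalarCurvature y
        ∂(riemannianVolume ((ofRiemannian h).inducedRiemannianMetric (F t) hpb
          (Hc.isSpacelikeImmersion t ht)) 2) ≤ 8 * π)
    (hIBP : haveI := ((ofRiemannian h).inducedMetric (F t) hpb
        (Hc.isSpacelikeImmersion t ht)).hasLeviCivita
      0 ≤ ∫ y, (ofRiemannian h).meanCurvature (F t) hpb (Hc.isSpacelikeImmersion t ht) (ν t) y *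
        ((ofRiemannian h).inducedMetric (F t) hpb (Hc.isSpacelikeImmersion t ht)).dalembertian
          (fun z ↦ ((ofRiemannian h).meanCurvature (F t) hpb (Hc.isSpacelikeImmersion t ht)
            (ν t) z)⁻¹) y
        ∂(riemannianVolume ((ofRiemannian h).inducedRiemannianMetric (F t) hpb
          (Hc.isSpacelikeImmersion t ht)) 2))
    (hiHL : haveI := ((ofRiemannian h).inducedMetric (F t) hpb
        (Hc.isSpacelikeImmersion t ht)).hasLeviCivita
      Integrable (fun y ↦ (ofRiemannian h).meanCurvature (F t) hpb (Hc.isSpacelikeImmersion t ht)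
          (ν t) y *
        ((ofRiemannian h).inducedMetric (F t) hpb (Hc.isSpacelikeImmersion t ht)).dalembertian
          (fun z ↦ ((ofRiemannian h).meanCurvature (F t) hpb (Hc.isSpacelikeImmersion t ht)
            (ν t) z)⁻¹) y)
        (riemannianVolume ((ofRiemannian h).inducedRiemannianMetric (F t) hpb
          (Hc.isSpacelikeImmersion t ht)) 2))
    (hiA : Integrable (fun y ↦
        ((ofRiemannian h).inducedMetric (F t) hpb (Hc.isSpacelikeImmersion t ht)).normSq y
          ((ofRiemannian h).secondFundamentalForm (𝓡 2) (F t) (ν t) y))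
        (riemannianVolume ((ofRiemannian h).inducedRiemannianMetric (F t) hpb
          (Hc.isSpacelikeImmersion t ht)) 2))
    (hiR : Integrable (fun y ↦ (ofRiemannian h).scalarCurvature (F t y))
        (riemannianVolume ((ofRiemannian h).inducedRiemannianMetric (F t) hpb
          (Hc.isSpacelikeImmersion t ht)) 2))
    (hiK : haveI := ((ofRiemannian h).inducedMetric (F t) hpb
        (Hc.isSpacelikeImmersion t ht)).hasLeviCivita
      Integrable (fun y ↦
        ((ofRiemannian h).inducedMetric (F t) hpb (Hc.isSpacelikeImmersion t ht)).scalarCurvature y)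
        (riemannianVolume ((ofRiemannian h).inducedRiemannianMetric (F t) hpb
          (Hc.isSpacelikeImmersion t ht)) 2))
    (hiH : Integrable (fun y ↦
        (ofRiemannian h).meanCurvature (F t) hpb (Hc.isSpacelikeImmersion t ht) (ν t) y ^ 2)
        (riemannianVolume ((ofRiemannian h).inducedRiemannianMetric (F t) hpb
          (Hc.isSpacelikeImmersion t ht)) 2)) :
    ∃ W' : ℝ, HasDerivAt Hc.sqMeanCurvatureIntegral W' t ∧
      W' ≤ 2⁻¹ * (16 * π - Hc.sqMeanCurvatureIntegral t) := by
  refine ⟨_, hD, ?_⟩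
  rw [Hc.sqMeanCurvatureIntegral_of_mem ht]
  exact integral_geroch_le (R := fun y ↦ (ofRiemannian h).scalarCurvature (F t y))
    (fun y ↦ (Hc.meanCurvature_pos t ht y).ne') hevol hGauss
    (fun y ↦ half_meanCurvature_sq_le_normSq_secondFundamentalForm (ofRiemannian h) (F t) hpb
      (Hc.isSpacelikeImmersion t ht) (ν t) y)
    (fun y ↦ hR (F t y)) hiHL hiA hiR hiK hiH hIBP hGB

end Classical

/-! ### The named fact from step 1, and from the classical inputs -/

/-- **`geroch_monotonicity_smooth` from step 1 of the Monotonicity Calculation.** If for every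
classical solution of the inverse mean curvature flow by a compact connected surface in a
Riemannian `3`-manifold with `R ≥ 0` the energy `W(t) = ∫_{N_t} H²` satisfies
`W'(t) ≤ ½(16π - W(t))` on `(a, b)` (hypothesis `hW`, Huisken–Ilmanen's step 1), then the
Hawking mass is nondecreasing along every such solution, i.e. the named fact
`geroch_monotonicity_smooth` holds: steps 2–3 are `IsClassicalIMCF.hawkingMass_mono_of_area_exp`
(`GerochMonotonicity.lean`) and (1.1) is the theorem `area_exp_classical_holds`
(`InverseMeanCurvatureFlowArea.lean`). Huisken–Ilmanen 2001, §5, Monotonicity Calculation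
(smooth case). [cite: HuiskenIlmanenIMCF2001, §5 Monotonicity Calculation (smooth case)] -/
theorem geroch_monotonicity_smooth_of_hasDerivAt
    (hW : ∀ (X : Type) [TopologicalSpace X] [ChartedSpace E3 X] [IsManifold (𝓡 3) ∞ X]
      [T2Space X] [SecondCountableTopology X]
      (h : ContMDiffRiemannianMetric (𝓡 3) ∞ E3 (TangentSpace (𝓡 3) : X → Type _))
      [(ofRiemannian h).HasLeviCivita]
      (S : Type) [TopologicalSpace S] [ChartedSpace (EuclideanSpace ℝ (Fin 2)) S]
      [IsManifold (𝓡 2) ∞ S] [CompactSpace S] [T2Space S] [ConnectedSpace S]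
      [MeasurableSpace S] [BorelSpace S]
      (hpb : contMDiff_pullbackBilin (𝓡 3) X (𝓡 2) S ∞)
      (F : ℝ → S → X) (ν : (t : ℝ) → NormalField (𝓡 3) (F t)) (a b : ℝ)
      (Hc : IsClassicalIMCF h hpb F ν a b),
      (∀ x : X, 0 ≤ (ofRiemannian h).scalarCurvature x) →
      ∀ t ∈ Set.Ioo a b, ∃ W' : ℝ, HasDerivAt Hc.sqMeanCurvatureIntegral W' t ∧
        W' ≤ 2⁻¹ * (16 * π - Hc.sqMeanCurvatureIntegral t)) :
    geroch_monotonicity_smooth := by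
  intro X _ _ _ _ _ h _ S _ _ _ _ _ _ _ _ hpb F ν a b Hc hR s t hs ht hst
  exact Hc.hawkingMass_mono_of_area_exp area_exp_classical_holds (hW X h S hpb F ν a b Hc hR)
    hs ht hst

/-- **`geroch_monotonicity_smooth` from the four classical inputs.** If for every classical
solution `(F, ν)` of the inverse mean curvature flow on `(a, b)` by a compact connected surface
`S` in a Riemannian `3`-manifold `(X, h)` with `R ≥ 0`, and every `t ∈ (a, b)`, the inputs
(F1)–(F4) of `IsClassicalIMCF.hasDerivAt_sqMeanCurvatureIntegral_le` hold — (F1) the derivative of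
`∫_{N_t} H² dμ_t` by (1.1), (1.3) and differentiation under the integral sign, (F2) the Gauss
equation, (F3) Gauss–Bonnet with `χ(N_t) ≤ 2`, (F4) the integration by parts
`0 ≤ ∫ H Δ(H⁻¹)`, with the integrability of the terms — then `geroch_monotonicity_smooth` holds.
This is the complete printed argument of Huisken–Ilmanen 2001, §5, Monotonicity Calculation
(smooth case), with (1.1) (`area_exp_classical_holds`), `½H² ≤ |A|²`, the integral calculus and
steps 2–3 proved in the tree, and (F1)–(F4) as hypotheses.
[cite: HuiskenIlmanenIMCF2001, §5 Monotonicity Calculation (smooth case)] -/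
theorem geroch_monotonicity_smooth_of_inputs
    (hin : ∀ (X : Type) [TopologicalSpace X] [ChartedSpace E3 X] [IsManifold (𝓡 3) ∞ X]
      [T2Space X] [SecondCountableTopology X]
      (h : ContMDiffRiemannianMetric (𝓡 3) ∞ E3 (TangentSpace (𝓡 3) : X → Type _))
      [(ofRiemannian h).HasLeviCivita]
      (S : Type) [TopologicalSpace S] [ChartedSpace (EuclideanSpace ℝ (Fin 2)) S]
      [IsManifold (𝓡 2) ∞ S] [CompactSpace S] [T2Space S] [ConnectedSpace S]
      [MeasurableSpace S] [BorelSpace S]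
      (hpb : contMDiff_pullbackBilin (𝓡 3) X (𝓡 2) S ∞)
      (F : ℝ → S → X) (ν : (t : ℝ) → NormalField (𝓡 3) (F t)) (a b : ℝ)
      (Hc : IsClassicalIMCF h hpb F ν a b),
      (∀ x : X, 0 ≤ (ofRiemannian h).scalarCurvature x) →
      ∀ t (ht : t ∈ Set.Ioo a b),
      haveI := ((ofRiemannian h).inducedMetric (F t) hpb (Hc.isSpacelikeImmersion t ht)).hasLeviCivita
      ∃ dH : S → ℝ,
        -- (F1) derivative of `W` …
        HasDerivAt Hc.sqMeanCurvatureIntegral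
          (∫ y, (2 * (ofRiemannian h).meanCurvature (F t) hpb (Hc.isSpacelikeImmersion t ht) (ν t) y *
              dH y +
            (ofRiemannian h).meanCurvature (F t) hpb (Hc.isSpacelikeImmersion t ht) (ν t) y ^ 2)
            ∂(riemannianVolume ((ofRiemannian h).inducedRiemannianMetric (F t) hpb
              (Hc.isSpacelikeImmersion t ht)) 2)) t ∧
        -- … with the evolution equation (1.3) for `dH`
        (∀ y, dH y =
          -((ofRiemannian h).inducedMetric (F t) hpb (Hc.isSpacelikeImmersion t ht)).dalembertian
              (fun z ↦ ((ofRiemannian h).meanCurvature (F t) hpb (Hc.isSpacelikeImmersion t ht)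
                (ν t) z)⁻¹) y -
            (((ofRiemannian h).inducedMetric (F t) hpb (Hc.isSpacelikeImmersion t ht)).normSq y
                ((ofRiemannian h).secondFundamentalForm (𝓡 2) (F t) (ν t) y) +
              (ofRiemannian h).ricci (F t y) (ν t y) (ν t y)) /
            (ofRiemannian h).meanCurvature (F t) hpb (Hc.isSpacelikeImmersion t ht) (ν t) y) ∧
        -- (F2) Gauss equation
        (∀ y, ((ofRiemannian h).inducedMetric (F t) hpb
            (Hc.isSpacelikeImmersion t ht)).scalarCurvature y =
          (ofRiemannian h).scalarCurvature (F t y) -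
            2 * (ofRiemannian h).ricci (F t y) (ν t y) (ν t y) +
            (ofRiemannian h).meanCurvature (F t) hpb (Hc.isSpacelikeImmersion t ht) (ν t) y ^ 2 -
            ((ofRiemannian h).inducedMetric (F t) hpb (Hc.isSpacelikeImmersion t ht)).normSq y
              ((ofRiemannian h).secondFundamentalForm (𝓡 2) (F t) (ν t) y)) ∧
        -- (F3) Gauss–Bonnet with `χ ≤ 2`
        (∫ y, ((ofRiemannian h).inducedMetric (F t) hpb
            (Hc.isSpacelikeImmersion t ht)).scalarCurvature y
          ∂(riemannianVolume ((ofRiemannian h).inducedRiemannianMetric (F t) hpb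
            (Hc.isSpacelikeImmersion t ht)) 2) ≤ 8 * π) ∧
        -- (F4) integration by parts
        (0 ≤ ∫ y, (ofRiemannian h).meanCurvature (F t) hpb (Hc.isSpacelikeImmersion t ht) (ν t) y *
          ((ofRiemannian h).inducedMetric (F t) hpb (Hc.isSpacelikeImmersion t ht)).dalembertian
            (fun z ↦ ((ofRiemannian h).meanCurvature (F t) hpb (Hc.isSpacelikeImmersion t ht)
              (ν t) z)⁻¹) y
          ∂(riemannianVolume ((ofRiemannian h).inducedRiemannianMetric (F t) hpb
            (Hc.isSpacelikeImmersion t ht)) 2)) ∧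
        -- integrability of the terms
        Integrable (fun y ↦ (ofRiemannian h).meanCurvature (F t) hpb
            (Hc.isSpacelikeImmersion t ht) (ν t) y *
          ((ofRiemannian h).inducedMetric (F t) hpb (Hc.isSpacelikeImmersion t ht)).dalembertian
            (fun z ↦ ((ofRiemannian h).meanCurvature (F t) hpb (Hc.isSpacelikeImmersion t ht)
              (ν t) z)⁻¹) y)
          (riemannianVolume ((ofRiemannian h).inducedRiemannianMetric (F t) hpb
            (Hc.isSpacelikeImmersion t ht)) 2) ∧
        Integrable (fun y ↦
          ((ofRiemannian h).inducedMetric (F t) hpb (Hc.isSpacelikeImmersion t ht)).normSq y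
            ((ofRiemannian h).secondFundamentalForm (𝓡 2) (F t) (ν t) y))
          (riemannianVolume ((ofRiemannian h).inducedRiemannianMetric (F t) hpb
            (Hc.isSpacelikeImmersion t ht)) 2) ∧
        Integrable (fun y ↦ (ofRiemannian h).scalarCurvature (F t y))
          (riemannianVolume ((ofRiemannian h).inducedRiemannianMetric (F t) hpb
            (Hc.isSpacelikeImmersion t ht)) 2) ∧
        Integrable (fun y ↦
          ((ofRiemannian h).inducedMetric (F t) hpb (Hc.isSpacelikeImmersion t ht)).scalarCurvature y)
          (riemannianVolume ((ofRiemannian h).inducedRiemannianMetric (F t) hpb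
            (Hc.isSpacelikeImmersion t ht)) 2) ∧
        Integrable (fun y ↦
          (ofRiemannian h).meanCurvature (F t) hpb (Hc.isSpacelikeImmersion t ht) (ν t) y ^ 2)
          (riemannianVolume ((ofRiemannian h).inducedRiemannianMetric (F t) hpb
            (Hc.isSpacelikeImmersion t ht)) 2)) :
    geroch_monotonicity_smooth := by
  refine geroch_monotonicity_smooth_of_hasDerivAt ?_
  intro X _ _ _ _ _ h _ S _ _ _ _ _ _ _ _ hpb F ν a b Hc hR t ht
  obtain ⟨dH, hD, hevol, hGauss, hGB, hIBP, hiHL, hiA, hiR, hiK, hiH⟩ :=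
    hin X h S hpb F ν a b Hc hR t ht
  exact Hc.hasDerivAt_sqMeanCurvatureIntegral_le hR ht hD hevol hGauss hGB hIBP hiHL hiA hiR hiK hiH

/-! ### (F4) from Green's identity on the closed leaf -/

section Green

variable {X : Type*} [TopologicalSpace X] [ChartedSpace E3 X] [IsManifold (𝓡 3) ∞ X]
  {h : ContMDiffRiemannianMetric (𝓡 3) ∞ E3 (TangentSpace (𝓡 3) : X → Type _)}
  [(ofRiemannian h).HasLeviCivita]
  {S : Type*} [TopologicalSpace S] [ChartedSpace (EuclideanSpace ℝ (Fin 2)) S]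
  [IsManifold (𝓡 2) ∞ S] [CompactSpace S] [T2Space S] [MeasurableSpace S] [BorelSpace S]
  {hpb : contMDiff_pullbackBilin (𝓡 3) X (𝓡 2) S ∞}
  {F : ℝ → S → X} {ν : (t : ℝ) → NormalField (𝓡 3) (F t)} {a b : ℝ}

/-- **Hypothesis (F4) of the Monotonicity Calculation is a theorem for leaves with `C²` mean
curvature**: for a classical solution of the inverse mean curvature flow by a compact surface and
`t ∈ (a, b)`, if the mean curvature `H` of the leaf `N_t` is `C²` on `S` then
`0 ≤ ∫_{N_t} H Δ_{g_t}(H⁻¹) dμ_t` (`H > 0` by the flow; Green's first identity on the closed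
Riemannian surface `(S, g_t = F_t^* h)`, `integral_mul_dalembertian_inv_nonneg` of
`GreenIdentity.lean`: `∫ H Δ(H⁻¹) = ∫ |dH|²_{g_t}/H² ≥ 0`). Huisken–Ilmanen 2001, §5,
Monotonicity Calculation: "`∫ −2HΔ(H⁻¹) … = ∫ −2|DH|²/H²`".
[cite: HuiskenIlmanenIMCF2001, §5 Monotonicity Calculation (integration by parts)] -/
theorem IsClassicalIMCF.integral_meanCurvature_mul_dalembertian_inv_nonneg
    (Hc : IsClassicalIMCF h hpb F ν a b) {t : ℝ} (ht : t ∈ Set.Ioo a b)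
    (hH2 : ContMDiff (𝓡 2) 𝓘(ℝ, ℝ) 2
      (fun y ↦ (ofRiemannian h).meanCurvature (F t) hpb (Hc.isSpacelikeImmersion t ht) (ν t) y)) :
    haveI := ((ofRiemannian h).inducedMetric (F t) hpb (Hc.isSpacelikeImmersion t ht)).hasLeviCivita
    0 ≤ ∫ y, (ofRiemannian h).meanCurvature (F t) hpb (Hc.isSpacelikeImmersion t ht) (ν t) y *
      ((ofRiemannian h).inducedMetric (F t) hpb (Hc.isSpacelikeImmersion t ht)).dalembertian
        (fun z ↦ ((ofRiemannian h).meanCurvature (F t) hpb (Hc.isSpacelikeImmersion t ht)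
          (ν t) z)⁻¹) y
      ∂(riemannianVolume ((ofRiemannian h).inducedRiemannianMetric (F t) hpb
        (Hc.isSpacelikeImmersion t ht)) 2) := by
  haveI := ((ofRiemannian h).inducedMetric (F t) hpb (Hc.isSpacelikeImmersion t ht)).hasLeviCivita
  haveI : (ofRiemannian ((ofRiemannian h).inducedRiemannianMetric (F t) hpb
      (Hc.isSpacelikeImmersion t ht))).HasLeviCivita :=
    PseudoRiemannianMetric.hasLeviCivita _
  have hne : ∀ y, (ofRiemannian h).meanCurvature (F t) hpb (Hc.isSpacelikeImmersion t ht) (ν t) y ≠ 0 :=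
    fun y ↦ (Hc.meanCurvature_pos t ht y).ne'
  have key := integral_mul_dalembertian_inv_nonneg (I := 𝓡 2)
    ((ofRiemannian h).inducedRiemannianMetric (F t) hpb (Hc.isSpacelikeImmersion t ht)) hH2 hne
  rw [riemannianMeasure_eq_riemannianVolume] at key
  exact key

/-- **Step 1 of the Monotonicity Calculation from (F1)–(F3) and the regularity `H ∈ C²(N_t)`**:
`IsClassicalIMCF.hasDerivAt_sqMeanCurvatureIntegral_le` with hypothesis (F4) discharged by
`integral_meanCurvature_mul_dalembertian_inv_nonneg`. Huisken–Ilmanen 2001, §5, Monotonicity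
Calculation (smooth case), step 1.
[cite: HuiskenIlmanenIMCF2001, §5 Monotonicity Calculation (smooth case), step 1] -/
theorem IsClassicalIMCF.hasDerivAt_sqMeanCurvatureIntegral_le_of_contMDiff
    (Hc : IsClassicalIMCF h hpb F ν a b)
    (hR : ∀ x : X, 0 ≤ (ofRiemannian h).scalarCurvature x) {t : ℝ} (ht : t ∈ Set.Ioo a b)
    (hH2 : ContMDiff (𝓡 2) 𝓘(ℝ, ℝ) 2
      (fun y ↦ (ofRiemannian h).meanCurvature (F t) hpb (Hc.isSpacelikeImmersion t ht) (ν t) y))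
    {dH : S → ℝ}
    (hD : HasDerivAt Hc.sqMeanCurvatureIntegral
      (∫ y, (2 * (ofRiemannian h).meanCurvature (F t) hpb (Hc.isSpacelikeImmersion t ht) (ν t) y *
          dH y + (ofRiemannian h).meanCurvature (F t) hpb (Hc.isSpacelikeImmersion t ht) (ν t) y ^ 2)
        ∂(riemannianVolume ((ofRiemannian h).inducedRiemannianMetric (F t) hpb
          (Hc.isSpacelikeImmersion t ht)) 2)) t)
    (hevol : haveI := ((ofRiemannian h).inducedMetric (F t) hpb
        (Hc.isSpacelikeImmersion t ht)).hasLeviCivita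
      ∀ y, dH y =
        -((ofRiemannian h).inducedMetric (F t) hpb (Hc.isSpacelikeImmersion t ht)).dalembertian
            (fun z ↦ ((ofRiemannian h).meanCurvature (F t) hpb (Hc.isSpacelikeImmersion t ht)
              (ν t) z)⁻¹) y -
          (((ofRiemannian h).inducedMetric (F t) hpb (Hc.isSpacelikeImmersion t ht)).normSq y
              ((ofRiemannian h).secondFundamentalForm (𝓡 2) (F t) (ν t) y) +
            (ofRiemannian h).ricci (F t y) (ν t y) (ν t y)) /
          (ofRiemannian h).meanCurvature (F t) hpb (Hc.isSpacelikeImmersion t ht) (ν t) y)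
    (hGauss : haveI := ((ofRiemannian h).inducedMetric (F t) hpb
        (Hc.isSpacelikeImmersion t ht)).hasLeviCivita
      ∀ y, ((ofRiemannian h).inducedMetric (F t) hpb (Hc.isSpacelikeImmersion t ht)).scalarCurvature y =
        (ofRiemannian h).scalarCurvature (F t y) - 2 * (ofRiemannian h).ricci (F t y) (ν t y) (ν t y) +
          (ofRiemannian h).meanCurvature (F t) hpb (Hc.isSpacelikeImmersion t ht) (ν t) y ^ 2 -
          ((ofRiemannian h).inducedMetric (F t) hpb (Hc.isSpacelikeImmersion t ht)).normSq y
            ((ofRiemannian h).secondFundamentalForm (𝓡 2) (F t) (ν t) y))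
    (hGB : haveI := ((ofRiemannian h).inducedMetric (F t) hpb
        (Hc.isSpacelikeImmersion t ht)).hasLeviCivita
      ∫ y, ((ofRiemannian h).inducedMetric (F t) hpb (Hc.isSpacelikeImmersion t ht)).scalarCurvature y
        ∂(riemannianVolume ((ofRiemannian h).inducedRiemannianMetric (F t) hpb
          (Hc.isSpacelikeImmersion t ht)) 2) ≤ 8 * π)
    (hiHL : haveI := ((ofRiemannian h).inducedMetric (F t) hpb
        (Hc.isSpacelikeImmersion t ht)).hasLeviCivita
      Integrable (fun y ↦ (ofRiemannian h).meanCurvature (F t) hpb (Hc.isSpacelikeImmersion t ht)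
          (ν t) y *
        ((ofRiemannian h).inducedMetric (F t) hpb (Hc.isSpacelikeImmersion t ht)).dalembertian
          (fun z ↦ ((ofRiemannian h).meanCurvature (F t) hpb (Hc.isSpacelikeImmersion t ht)
            (ν t) z)⁻¹) y)
        (riemannianVolume ((ofRiemannian h).inducedRiemannianMetric (F t) hpb
          (Hc.isSpacelikeImmersion t ht)) 2))
    (hiA : Integrable (fun y ↦
        ((ofRiemannian h).inducedMetric (F t) hpb (Hc.isSpacelikeImmersion t ht)).normSq y
          ((ofRiemannian h).secondFundamentalForm (𝓡 2) (F t) (ν t) y))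
        (riemannianVolume ((ofRiemannian h).inducedRiemannianMetric (F t) hpb
          (Hc.isSpacelikeImmersion t ht)) 2))
    (hiR : Integrable (fun y ↦ (ofRiemannian h).scalarCurvature (F t y))
        (riemannianVolume ((ofRiemannian h).inducedRiemannianMetric (F t) hpb
          (Hc.isSpacelikeImmersion t ht)) 2))
    (hiK : haveI := ((ofRiemannian h).inducedMetric (F t) hpb
        (Hc.isSpacelikeImmersion t ht)).hasLeviCivita
      Integrable (fun y ↦
        ((ofRiemannian h).inducedMetric (F t) hpb (Hc.isSpacelikeImmersion t ht)).scalarCurvature y)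
        (riemannianVolume ((ofRiemannian h).inducedRiemannianMetric (F t) hpb
          (Hc.isSpacelikeImmersion t ht)) 2))
    (hiH : Integrable (fun y ↦
        (ofRiemannian h).meanCurvature (F t) hpb (Hc.isSpacelikeImmersion t ht) (ν t) y ^ 2)
        (riemannianVolume ((ofRiemannian h).inducedRiemannianMetric (F t) hpb
          (Hc.isSpacelikeImmersion t ht)) 2)) :
    ∃ W' : ℝ, HasDerivAt Hc.sqMeanCurvatureIntegral W' t ∧
      W' ≤ 2⁻¹ * (16 * π - Hc.sqMeanCurvatureIntegral t) :=
  Hc.hasDerivAt_sqMeanCurvatureIntegral_le hR ht hD hevol hGauss hGB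
    (Hc.integral_meanCurvature_mul_dalembertian_inv_nonneg ht hH2) hiHL hiA hiR hiK hiH

end Green

/-! ### (F4) discharged outright: the mean curvature of a leaf is smooth -/

section Regularity

variable {X : Type*} [TopologicalSpace X] [ChartedSpace E3 X] [IsManifold (𝓡 3) ∞ X]
  {h : ContMDiffRiemannianMetric (𝓡 3) ∞ E3 (TangentSpace (𝓡 3) : X → Type _)}
  [(ofRiemannian h).HasLeviCivita]
  {S : Type*} [TopologicalSpace S] [ChartedSpace (EuclideanSpace ℝ (Fin 2)) S]
  [IsManifold (𝓡 2) ∞ S]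
  {hpb : contMDiff_pullbackBilin (𝓡 3) X (𝓡 2) S ∞}
  {F : ℝ → S → X} {ν : (t : ℝ) → NormalField (𝓡 3) (F t)} {a b : ℝ}

/-- **The mean curvature of every leaf of a classical solution is `C^∞`**: `F t` is a smooth
spacelike immersion and `ν t` a smooth field along it (`IsClassicalIMCF`), so
`contMDiff_meanCurvature` (`MeanCurvatureRegularity.lean`) applies. Huisken–Ilmanen 2001, §0 (∗)
("a smooth family of hypersurfaces"; `H` is then a smooth function on each `N_t`).
[cite: HuiskenIlmanenIMCF2001, §0 (∗)] -/
theorem IsClassicalIMCF.contMDiff_meanCurvature (Hc : IsClassicalIMCF h hpb F ν a b) {t : ℝ}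
    (ht : t ∈ Set.Ioo a b) :
    ContMDiff (𝓡 2) 𝓘(ℝ, ℝ) ∞
      (fun y ↦ (ofRiemannian h).meanCurvature (F t) hpb (Hc.isSpacelikeImmersion t ht) (ν t) y) :=
  (ofRiemannian h).contMDiff_meanCurvature hpb (Hc.isSpacelikeImmersion t ht) (ν t)
    (Hc.contMDiff_normal t ht)

variable [CompactSpace S] [T2Space S] [MeasurableSpace S] [BorelSpace S]

/-- **Hypothesis (F4) of the Monotonicity Calculation holds for every classical solution**:
`0 ≤ ∫_{N_t} H Δ_{g_t}(H⁻¹) dμ_t` for a classical solution by a compact surface and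
`t ∈ (a, b)` — `integral_meanCurvature_mul_dalembertian_inv_nonneg` with the regularity
`H ∈ C^∞(N_t)` of `contMDiff_meanCurvature`. Huisken–Ilmanen 2001, §5, Monotonicity
Calculation (the integration by parts `∫ −2HΔ(H⁻¹) = ∫ −2|DH|²/H²`).
[cite: HuiskenIlmanenIMCF2001, §5 Monotonicity Calculation (integration by parts)] -/
theorem IsClassicalIMCF.integral_meanCurvature_mul_dalembertian_inv_nonneg'
    (Hc : IsClassicalIMCF h hpb F ν a b) {t : ℝ} (ht : t ∈ Set.Ioo a b) :
    haveI := ((ofRiemannian h).inducedMetric (F t) hpb (Hc.isSpacelikeImmersion t ht)).hasLeviCivita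
    0 ≤ ∫ y, (ofRiemannian h).meanCurvature (F t) hpb (Hc.isSpacelikeImmersion t ht) (ν t) y *
      ((ofRiemannian h).inducedMetric (F t) hpb (Hc.isSpacelikeImmersion t ht)).dalembertian
        (fun z ↦ ((ofRiemannian h).meanCurvature (F t) hpb (Hc.isSpacelikeImmersion t ht)
          (ν t) z)⁻¹) y
      ∂(riemannianVolume ((ofRiemannian h).inducedRiemannianMetric (F t) hpb
        (Hc.isSpacelikeImmersion t ht)) 2) :=
  Hc.integral_meanCurvature_mul_dalembertian_inv_nonneg ht
    ((Hc.contMDiff_meanCurvature ht).of_le (by exact WithTop.coe_le_coe.2 le_top))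

end Regularity

/-- **`geroch_monotonicity_smooth` from (F1)–(F3).** As `geroch_monotonicity_smooth_of_inputs`, but
with hypothesis (F4) (`0 ≤ ∫ H Δ(H⁻¹)`) removed — it is a theorem for every classical solution
(`IsClassicalIMCF.integral_meanCurvature_mul_dalembertian_inv_nonneg'`: Green's identity on the
closed leaf and the smoothness of its mean curvature). What enters as hypothesis is, for every
classical solution by a compact connected surface in a `3`-manifold with `R ≥ 0` and every time:
(F1) the derivative of `∫_{N_t} H² dμ_t` by (1.1), (1.3) and differentiation under the integral
sign, (F2) the Gauss equation, (F3) Gauss–Bonnet with `χ(N_t) ≤ 2`, and the integrability of the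
terms. Huisken–Ilmanen 2001, §5, Monotonicity Calculation (smooth case).
[cite: HuiskenIlmanenIMCF2001, §5 Monotonicity Calculation (smooth case)] -/
theorem geroch_monotonicity_smooth_of_inputs₃
    (hin : ∀ (X : Type) [TopologicalSpace X] [ChartedSpace E3 X] [IsManifold (𝓡 3) ∞ X]
      [T2Space X] [SecondCountableTopology X]
      (h : ContMDiffRiemannianMetric (𝓡 3) ∞ E3 (TangentSpace (𝓡 3) : X → Type _))
      [(ofRiemannian h).HasLeviCivita]
      (S : Type) [TopologicalSpace S] [ChartedSpace (EuclideanSpace ℝ (Fin 2)) S]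
      [IsManifold (𝓡 2) ∞ S] [CompactSpace S] [T2Space S] [ConnectedSpace S]
      [MeasurableSpace S] [BorelSpace S]
      (hpb : contMDiff_pullbackBilin (𝓡 3) X (𝓡 2) S ∞)
      (F : ℝ → S → X) (ν : (t : ℝ) → NormalField (𝓡 3) (F t)) (a b : ℝ)
      (Hc : IsClassicalIMCF h hpb F ν a b),
      (∀ x : X, 0 ≤ (ofRiemannian h).scalarCurvature x) →
      ∀ t (ht : t ∈ Set.Ioo a b),
      haveI := ((ofRiemannian h).inducedMetric (F t) hpb (Hc.isSpacelikeImmersion t ht)).hasLeviCivita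
      ∃ dH : S → ℝ,
        -- (F1) derivative of `W` …
        HasDerivAt Hc.sqMeanCurvatureIntegral
          (∫ y, (2 * (ofRiemannian h).meanCurvature (F t) hpb (Hc.isSpacelikeImmersion t ht) (ν t) y *
              dH y +
            (ofRiemannian h).meanCurvature (F t) hpb (Hc.isSpacelikeImmersion t ht) (ν t) y ^ 2)
            ∂(riemannianVolume ((ofRiemannian h).inducedRiemannianMetric (F t) hpb
              (Hc.isSpacelikeImmersion t ht)) 2)) t ∧
        -- … with the evolution equation (1.3) for `dH`
        (∀ y, dH y =
          -((ofRiemannian h).inducedMetric (F t) hpb (Hc.isSpacelikeImmersion t ht)).dalembertian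
              (fun z ↦ ((ofRiemannian h).meanCurvature (F t) hpb (Hc.isSpacelikeImmersion t ht)
                (ν t) z)⁻¹) y -
            (((ofRiemannian h).inducedMetric (F t) hpb (Hc.isSpacelikeImmersion t ht)).normSq y
                ((ofRiemannian h).secondFundamentalForm (𝓡 2) (F t) (ν t) y) +
              (ofRiemannian h).ricci (F t y) (ν t y) (ν t y)) /
            (ofRiemannian h).meanCurvature (F t) hpb (Hc.isSpacelikeImmersion t ht) (ν t) y) ∧
        -- (F2) Gauss equation
        (∀ y, ((ofRiemannian h).inducedMetric (F t) hpb
            (Hc.isSpacelikeImmersion t ht)).scalarCurvature y =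
          (ofRiemannian h).scalarCurvature (F t y) -
            2 * (ofRiemannian h).ricci (F t y) (ν t y) (ν t y) +
            (ofRiemannian h).meanCurvature (F t) hpb (Hc.isSpacelikeImmersion t ht) (ν t) y ^ 2 -
            ((ofRiemannian h).inducedMetric (F t) hpb (Hc.isSpacelikeImmersion t ht)).normSq y
              ((ofRiemannian h).secondFundamentalForm (𝓡 2) (F t) (ν t) y)) ∧
        -- (F3) Gauss–Bonnet with `χ ≤ 2`
        (∫ y, ((ofRiemannian h).inducedMetric (F t) hpb
            (Hc.isSpacelikeImmersion t ht)).scalarCurvature y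
          ∂(riemannianVolume ((ofRiemannian h).inducedRiemannianMetric (F t) hpb
            (Hc.isSpacelikeImmersion t ht)) 2) ≤ 8 * π) ∧
        -- integrability of the terms
        Integrable (fun y ↦ (ofRiemannian h).meanCurvature (F t) hpb
            (Hc.isSpacelikeImmersion t ht) (ν t) y *
          ((ofRiemannian h).inducedMetric (F t) hpb (Hc.isSpacelikeImmersion t ht)).dalembertian
            (fun z ↦ ((ofRiemannian h).meanCurvature (F t) hpb (Hc.isSpacelikeImmersion t ht)
              (ν t) z)⁻¹) y)
          (riemannianVolume ((ofRiemannian h).inducedRiemannianMetric (F t) hpb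
            (Hc.isSpacelikeImmersion t ht)) 2) ∧
        Integrable (fun y ↦
          ((ofRiemannian h).inducedMetric (F t) hpb (Hc.isSpacelikeImmersion t ht)).normSq y
            ((ofRiemannian h).secondFundamentalForm (𝓡 2) (F t) (ν t) y))
          (riemannianVolume ((ofRiemannian h).inducedRiemannianMetric (F t) hpb
            (Hc.isSpacelikeImmersion t ht)) 2) ∧
        Integrable (fun y ↦ (ofRiemannian h).scalarCurvature (F t y))
          (riemannianVolume ((ofRiemannian h).inducedRiemannianMetric (F t) hpb
            (Hc.isSpacelikeImmersion t ht)) 2) ∧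
        Integrable (fun y ↦
          ((ofRiemannian h).inducedMetric (F t) hpb (Hc.isSpacelikeImmersion t ht)).scalarCurvature y)
          (riemannianVolume ((ofRiemannian h).inducedRiemannianMetric (F t) hpb
            (Hc.isSpacelikeImmersion t ht)) 2) ∧
        Integrable (fun y ↦
          (ofRiemannian h).meanCurvature (F t) hpb (Hc.isSpacelikeImmersion t ht) (ν t) y ^ 2)
          (riemannianVolume ((ofRiemannian h).inducedRiemannianMetric (F t) hpb
            (Hc.isSpacelikeImmersion t ht)) 2)) :
    geroch_monotonicity_smooth := by
  refine geroch_monotonicity_smooth_of_hasDerivAt ?_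
  intro X _ _ _ _ _ h _ S _ _ _ _ _ _ _ _ hpb F ν a b Hc hR t ht
  obtain ⟨dH, hD, hevol, hGauss, hGB, hiHL, hiA, hiR, hiK, hiH⟩ :=
    hin X h S hpb F ν a b Hc hR t ht
  exact Hc.hasDerivAt_sqMeanCurvatureIntegral_le_of_contMDiff hR ht
    ((Hc.contMDiff_meanCurvature ht).of_le (by exact WithTop.coe_le_coe.2 le_top)) hD hevol hGauss hGB hiHL
    hiA hiR hiK hiH

end Literature.Geometry.Lorentzian

end
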